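import Summits.Ventures.YMGap.BEDoor.Currency

/-!
# BEDoor / Theta — §4a the weighted Bochner inequality with GENERAL positive weights, §4 the typed gap list
# (module 02/11 of the Bakry–Émery door, LIFT edition v8.3 = parts `Theta` (v8.2 module 03), `Gaps` (v8.2 module 04); cell `ym-beyond`, seat P4)

HONEST FRAMING (cell `ym-beyond`, seat P4 «Hessian-currency receiver», lens Y2; HUMAN RULINGS D-0035 / D-0037; memo `HOME/ROUTE-P4Y2.md` v8.1 +
g10 addendum, spec `HOME/ROUTE-P4Y2-LIFT-SPEC-v83.md`; LIFT edition v8.3 = the v8.2 module bodies of `HOME/ROUTE-P4Y2-Sketch.lean` v8.1, byte-identical and in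
order, re-packed into 11 ≤ 400-line modules (fewer olean round-trips; director-ym line №2 (B)); the g10 appendix `OpenStrip` is a separate, UNQUEUED HOME file (line №3 (D))).  FINITE-LATTICE
statements at STRONG effective coupling: a RECEIVER («door») in HESSIAN (Bakry–Émery) currency for renormalisation-group output, typed over the
tree's generic clustering chain `Thresholds/SharpClustering*` + `Thresholds/LatticeBakryEmery*`, complementary to the Dobrushin-currency door
`YM4Door/*` (LITERALLY the same INPUT predicate `QuasiLocalGaugePerturbation.HasAnalyticNormLE … stripDomain`, the same OUTPUT predicate
`RobustBall.ClustersWith`; no residual hypothesis: Osgood regularity is the tree's `Literature.Analysis.Complex.SCV.contDiffOn_infty`,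
part `Osgood` of module `AnalyticStrip`).  Nothing here is a statement about `β → ∞`, the continuum limit or the Clay problem; NO effective action is asserted to be at
the door (that INPUT is not in print for `d = 4`); the verdict «the two windows do not meet» is unchanged in this currency.
WHAT THIS IS NOT (ladder rung R2d; director-ym line №2 (B)): every door of this LIFT is an entry on the STRONG-COUPLING BANK of THE NUMBER —
finite-lattice exponential clustering at SMALL `|β|` and small strip norm `η` of the perturbation (`SU(2)`, `d = 4`: `16.2|β| + 4.4η < 1`, module `SU2`,
conclusion literally `RobustBall.ClustersWith`) — NOT clustering at weak coupling, NOT a statement at large `β`, NOT the mass gap.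
No conjecture name, no `sorry`, no axiom beyond the standard three; every theorem is bookkeeping over the tree. [folklore]
References: H. Shen, R. Zhu, X. Zhu, CMP 400 (2023) 805 (arXiv:2204.12737) Thm 1.2, Cor. 4.4/4.11; D. Bakry, M. Émery, LNM 1123 (1985);
T. Bałaban, CMP 109 (1987) 249, (1.18)–(1.22) (analyticity format); L. Hörmander, An Introduction to Complex Analysis in Several Variables
(1973) Thm 2.2.1/2.2.6 (Osgood); E. J. McShane, Bull. AMS 40 (1934) 837 (Lipschitz extension).

THIS MODULE, part `Theta` (§4a the weighted Bochner inequality with GENERAL positive weights): ★ `Gam2W_ge_theta` (loss `Θ` = common bound of the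
row/column sums of `h e e'·|√(w e / w e') − 1|`; no admissibility, no range hypothesis — what a QUASI-LOCAL remainder needs),
`theta_le_of_admissible`, `Gam2W_ge_of_theta` (contains the tree theorem `SharpClustering.Gam2W_ge`).

THIS MODULE, part `Gaps` (§4 the typed gap list): `ThetaBochner` (a theorem: `thetaBochner_holds`), `CovarianceLeOfCurvature` (G1′, proved in
`Curvature.lean`), `SmoothCovarianceLe` (S-POISSON: DEFINED, not asserted; bypassed in `Approx.lean`).
-/

noncomputable section

open scoped Matrix ComplexConjugate BigOperators Matrix.Norms.Frobenius ContDiff Topology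
open Matrix Complex Finset MeasureTheory Filter
open Literature.MathematicalPhysics.QuantumFieldTheory
open Literature.MathematicalPhysics.QuantumFieldTheory.SUNBakryEmery (SUN FrameIdx frame)

namespace Summit.Ventures.YMGap.BEDoor

open Summit.Ventures.YMGap Summit.Ventures.YMGap.LatticeBakryEmery Summit.Ventures.YMGap.SharpClustering
open Summit.Ventures.YMGap.HessianSharp

universe u

/-! ## ── part 03 · `Theta` — §4a the weighted Bochner inequality with GENERAL positive weights ── -/

/-! ## §4a G1 at the Γ₂ level, PROVED: the weighted Bochner inequality with GENERAL positive weights -/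

section Theta

variable {ι : Type u} [Fintype ι] [DecidableEq ι] {N : ℕ}

omit [Fintype ι] [DecidableEq ι] in
/-- `|a − √a√b| = √a·√b·|√(a/b) − 1|` for `a, b > 0`. [folklore] -/
theorem abs_sub_sqrt_mul_sqrt_eq {a b : ℝ} (ha : 0 < a) (hb : 0 < b) :
    |a - Real.sqrt a * Real.sqrt b| = Real.sqrt a * Real.sqrt b * |Real.sqrt (a / b) - 1| := by
  have hsa : 0 < Real.sqrt a := Real.sqrt_pos.2 ha
  have hsb : 0 < Real.sqrt b := Real.sqrt_pos.2 hb
  rw [Real.sqrt_div ha.le]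
  have h1 : Real.sqrt a / Real.sqrt b - 1 = (Real.sqrt a - Real.sqrt b) / Real.sqrt b := by
    field_simp
  have hkey : a - Real.sqrt a * Real.sqrt b = Real.sqrt a * (Real.sqrt a - Real.sqrt b) := by
    rw [mul_sub, Real.mul_self_sqrt ha.le]
  rw [h1, abs_div, abs_of_pos hsb, hkey, abs_mul, abs_of_pos hsa]
  field_simp

/-- ★ **G1 (Θ-BOCHNER), PROVED.**  The tree's weighted curvature bound `SharpClustering.Gam2W_ge` with GENERAL positive
link weights `w`: the admissibility hypothesis `AdmissibleWeights h ρ w` and its loss `(√ρ − 1)·H` are replaced by any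
common bound `Θ` of the row sums (over `e'`) and column sums (over `e`) of `θ e e' := h e e' · |√(w e / w e') − 1|`:
`Γ₂^w(u) ≥ (N/2 − Λ − Θ)·Γ^w(u,u)` pointwise on `SU(N)^E`.  Proof = the tree's proof verbatim except for the
antisymmetric term, where `c(e,e')·D_e u·D_{e'}u·D_eD_{e'}S` is bounded using
`|c(e,e')| = √w_e √w_{e'} |√(w_e/w_{e'}) − 1|` and `2(√w_e n_e)(√w_{e'} n_{e'}) ≤ w_e n_e² + w_{e'} n_{e'}²`.
For all-pairs-interacting (quasi-local) `h` this is the form that still decays: with `w = ρ^{D}`,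
`Θ ≤ sup_e Σ_{e'} h e e' (ρ^{|D e − D e'|/2} − 1) → 0` as `ρ → 1`. [folklore] -/
theorem Gam2W_ge_theta (hN : N ≠ 0) {S u : Cfg ι N → ℝ} (hS : ContDiff ℝ ∞ S) (hu : ContDiff ℝ ∞ u)
    {Λ Θ : ℝ} {h : ι → ι → ℝ} {w : ι → ℝ} (hHess : HessBound S Λ) (hOff : OffDiagHessBound S h)
    (hh0 : ∀ e e', 0 ≤ h e e') (hw : ∀ e, 0 < w e)
    (hrow : ∀ e, ∑ e', h e e' * |Real.sqrt (w e / w e') - 1| ≤ Θ)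
    (hcol : ∀ e', ∑ e, h e e' * |Real.sqrt (w e / w e') - 1| ≤ Θ) (g : PSU ι N) :
    ((N : ℝ) / 2 - Λ - Θ) * GamW w u u (emb g) ≤ Gam2W w S u (emb g) := by
  set Q : Cfg ι N := emb g with hQ
  have hw0 : ∀ e, 0 ≤ w e := fun e => (hw e).le
  have hwsq : ∀ e, Real.sqrt (w e) * Real.sqrt (w e) = w e := fun e => Real.mul_self_sqrt (hw0 e)
  set θ : ι → ι → ℝ := fun e e' => h e e' * |Real.sqrt (w e / w e') - 1| with hθ
  have hθ0 : ∀ e e', 0 ≤ θ e e' := fun e e' => mul_nonneg (hh0 e e') (abs_nonneg _)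
  -- the three pieces of the Bochner identity (verbatim from the tree)
  set A := ∑ a : BIdx ι N, ∑ b : BIdx ι N, w a.1 * algD (bframe b) (algD (bframe a) u) Q ^ 2 with hA
  set Tsym := ∑ a : BIdx ι N, ∑ b : BIdx ι N,
      (Real.sqrt (w a.1) * algD (bframe a) u Q) * (Real.sqrt (w b.1) * algD (bframe b) u Q) *
        algD (bframe a) (algD (bframe b) S) Q with hTsym
  set c : ι → ι → ℝ := fun e e' => w e - Real.sqrt (w e) * Real.sqrt (w e') with hc
  set Tasym := ∑ a : BIdx ι N, ∑ b : BIdx ι N,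
      c a.1 b.1 * (algD (bframe a) u Q * algD (bframe b) u Q * algD (bframe a) (algD (bframe b) S) Q) with hTasym
  have hsplit : Gam2W w S u Q = A - Tsym - Tasym := by
    rw [Gam2W_eq hN w hS hu Q, hA, hTsym, hTasym, sub_sub, ← sum_add_distrib]
    congr 1
    refine sum_congr rfl fun a _ => ?_
    rw [← sum_add_distrib]
    refine sum_congr rfl fun b _ => ?_
    simp only [hc]
    ring
  -- Ricci
  have hRic : (N : ℝ) / 2 * GamW w u u Q ≤ A := ricci_GamW_le hN hw0 hu Q
  -- symmetric Hessian part
  have hSym : |Tsym| ≤ Λ * GamW w u u Q := by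
    rw [hTsym, sum_sum_hessW_sym_eq w hS u Q, ← sum_frobNorm_gradW_sq hN hw0 u Q]
    exact hHess g (gradW w u Q) (gradW_conjTranspose w u Q) (gradW_trace hN w u Q)
  -- antisymmetric part, NEW ESTIMATE
  have hAsym : |Tasym| ≤ Θ * GamW w u u Q := by
    rw [hTasym, sum_sum_coef_hess_eq c hS u Q]
    set n : ι → ℝ := fun e => frobNorm (grad u Q e) with hn
    have hn0 : ∀ e, 0 ≤ n e := fun e => frobNorm_nonneg _
    have hterm : ∀ e e' : ι, |c e e' * hessBlock S u Q e e'| ≤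
        1 / 2 * θ e e' * (w e * n e ^ 2 + w e' * n e' ^ 2) := by
      intro e e'
      have hR : 0 ≤ 1 / 2 * θ e e' * (w e * n e ^ 2 + w e' * n e' ^ 2) :=
        mul_nonneg (mul_nonneg (by norm_num) (hθ0 e e')) (by nlinarith [hw0 e, hw0 e', hn0 e, hn0 e'])
      by_cases hee : e = e'
      · subst hee
        have : c e e = 0 := by simp only [hc, hwsq, sub_self]
        rw [this, zero_mul, abs_zero]
        exact hR
      have hB : |hessBlock S u Q e e'| ≤ h e e' * n e * n e' := by
        rw [hessBlock, hQ]
        exact hOff g e e' hee _ _ (grad_conjTranspose u _ e) (grad_trace hN u _ e)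
          (grad_conjTranspose u _ e') (grad_trace hN u _ e')
      by_cases hh : h e e' = 0
      · have hB0 : hessBlock S u Q e e' = 0 := by
          rw [hh, zero_mul, zero_mul] at hB
          exact abs_eq_zero.1 (le_antisymm hB (abs_nonneg _))
        rw [hB0, mul_zero, abs_zero]
        exact hR
      · have hcb : |c e e'| = Real.sqrt (w e) * Real.sqrt (w e') * |Real.sqrt (w e / w e') - 1| :=
          abs_sub_sqrt_mul_sqrt_eq (hw e) (hw e')
        rw [abs_mul, hcb]
        have ht : 0 ≤ h e e' * |Real.sqrt (w e / w e') - 1| := hθ0 e e'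
        have hprod : Real.sqrt (w e) * Real.sqrt (w e') * |Real.sqrt (w e / w e') - 1| * |hessBlock S u Q e e'| ≤
            Real.sqrt (w e) * Real.sqrt (w e') * |Real.sqrt (w e / w e') - 1| * (h e e' * n e * n e') :=
          mul_le_mul_of_nonneg_left hB (by positivity)
        refine hprod.trans ?_
        have hsq : 2 * (Real.sqrt (w e) * n e) * (Real.sqrt (w e') * n e') ≤ w e * n e ^ 2 + w e' * n e' ^ 2 := by
          have h0 := sq_nonneg (Real.sqrt (w e) * n e - Real.sqrt (w e') * n e')
          nlinarith [hwsq e, hwsq e']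
        calc Real.sqrt (w e) * Real.sqrt (w e') * |Real.sqrt (w e / w e') - 1| * (h e e' * n e * n e')
            = (h e e' * |Real.sqrt (w e / w e') - 1|) * ((Real.sqrt (w e) * n e) * (Real.sqrt (w e') * n e')) := by
              ring
          _ ≤ (h e e' * |Real.sqrt (w e / w e') - 1|) * ((w e * n e ^ 2 + w e' * n e' ^ 2) / 2) :=
              mul_le_mul_of_nonneg_left (by linarith) ht
          _ = 1 / 2 * θ e e' * (w e * n e ^ 2 + w e' * n e' ^ 2) := by simp only [hθ]; ring
    -- sum the termwise bounds (verbatim from the tree with `(√ρ−1)/2·h` ↦ `θ/2`)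
    calc |∑ e, ∑ e', c e e' * hessBlock S u Q e e'|
        ≤ ∑ e, |∑ e', c e e' * hessBlock S u Q e e'| := abs_sum_le_sum_abs _ _
      _ ≤ ∑ e, ∑ e', |c e e' * hessBlock S u Q e e'| := sum_le_sum fun e _ => abs_sum_le_sum_abs _ _
      _ ≤ ∑ e, ∑ e', 1 / 2 * θ e e' * (w e * n e ^ 2 + w e' * n e' ^ 2) :=
          sum_le_sum fun e _ => sum_le_sum fun e' _ => hterm e e'
      _ = 1 / 2 * (∑ e, (∑ e', θ e e') * (w e * n e ^ 2)) +
          1 / 2 * (∑ e', (∑ e, θ e e') * (w e' * n e' ^ 2)) := by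
          have hL : ∑ e, ∑ e', 1 / 2 * θ e e' * (w e * n e ^ 2 + w e' * n e' ^ 2) =
              ∑ e, ∑ e', 1 / 2 * θ e e' * (w e * n e ^ 2) +
                ∑ e, ∑ e', 1 / 2 * θ e e' * (w e' * n e' ^ 2) := by
            rw [← sum_add_distrib]
            refine sum_congr rfl fun e _ => ?_
            rw [← sum_add_distrib]
            exact sum_congr rfl fun e' _ => by ring
          rw [hL, sum_comm (f := fun e e' => 1 / 2 * θ e e' * (w e' * n e' ^ 2))]
          congr 1
          · rw [mul_sum]
            refine sum_congr rfl fun e _ => ?_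
            rw [sum_mul, mul_sum]
            exact sum_congr rfl fun e' _ => by ring
          · rw [mul_sum]
            refine sum_congr rfl fun e' _ => ?_
            rw [sum_mul, mul_sum]
            exact sum_congr rfl fun e _ => by ring
      _ ≤ 1 / 2 * (Θ * GamW w u u Q) + 1 / 2 * (Θ * GamW w u u Q) := by
          have hG : GamW w u u Q = ∑ e, w e * n e ^ 2 := GamW_self_eq_sum_frobNorm_grad_sq hN w u Q
          have i1 : ∑ e, (∑ e', θ e e') * (w e * n e ^ 2) ≤ Θ * GamW w u u Q := by
            rw [hG, mul_sum]
            exact sum_le_sum fun e _ => mul_le_mul_of_nonneg_right (hrow e) (mul_nonneg (hw0 e) (sq_nonneg _))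
          have i2 : ∑ e', (∑ e, θ e e') * (w e' * n e' ^ 2) ≤ Θ * GamW w u u Q := by
            rw [hG, mul_sum]
            exact sum_le_sum fun e' _ => mul_le_mul_of_nonneg_right (hcol e') (mul_nonneg (hw0 e') (sq_nonneg _))
          have h12 : (0 : ℝ) ≤ 1 / 2 := by norm_num
          exact add_le_add (mul_le_mul_of_nonneg_left i1 h12) (mul_le_mul_of_nonneg_left i2 h12)
      _ = Θ * GamW w u u Q := by ring
  -- assemble
  rw [hsplit]
  have h1 := (abs_le.1 hSym).2
  have h2 := (abs_le.1 hAsym).2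
  nlinarith [hRic, h1, h2, GamW_self_nonneg hw0 u Q]

/-- The tree's admissible case is an instance: admissible weights of ratio `ρ` have `θ`-row and `θ`-column sums
`≤ (√ρ − 1)·H` (each `|√(w e/w e') − 1| ≤ √ρ − 1` on interacting pairs). [folklore] -/
theorem theta_le_of_admissible {h : ι → ι → ℝ} {w : ι → ℝ} {ρ H : ℝ} (hh0 : ∀ e e', 0 ≤ h e e')
    (hsymm : ∀ e e', h e e' = h e' e) (hrow : ∀ e, ∑ e', h e e' ≤ H) (hρ : 1 ≤ ρ)
    (hw : AdmissibleWeights h ρ w) :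
    (∀ e, ∑ e', h e e' * |Real.sqrt (w e / w e') - 1| ≤ (Real.sqrt ρ - 1) * H) ∧
      (∀ e', ∑ e, h e e' * |Real.sqrt (w e / w e') - 1| ≤ (Real.sqrt ρ - 1) * H) := by
  have hρ0 : 0 ≤ ρ := le_trans zero_le_one hρ
  have hsρ : 1 ≤ Real.sqrt ρ := by rw [← Real.sqrt_one]; exact Real.sqrt_le_sqrt hρ
  have hρ1 : 0 ≤ Real.sqrt ρ - 1 := by linarith
  -- pointwise: `h e e' * |√(w e/w e') − 1| ≤ (√ρ − 1) * h e e'`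
  have hpt : ∀ e e', h e e' * |Real.sqrt (w e / w e') - 1| ≤ (Real.sqrt ρ - 1) * h e e' := by
    intro e e'
    by_cases hh : h e e' = 0
    · rw [hh]; simp
    by_cases hee : e = e'
    · subst hee
      rw [div_self (hw.1 e).ne', Real.sqrt_one, sub_self, abs_zero, mul_zero]
      exact mul_nonneg hρ1 (hh0 e e)
    have h12 : w e ≤ ρ * w e' := hw.2 e e' hee hh
    have h21 : w e' ≤ ρ * w e := hw.2 e' e (Ne.symm hee) (by rwa [hsymm e' e])
    have hwe : 0 < w e := hw.1 e
    have hwe' : 0 < w e' := hw.1 e'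
    have hq_le : Real.sqrt (w e / w e') ≤ Real.sqrt ρ :=
      Real.sqrt_le_sqrt (by rw [div_le_iff₀ hwe']; exact h12)
    have hq_ge : 1 / Real.sqrt ρ ≤ Real.sqrt (w e / w e') := by
      rw [div_le_iff₀ (by linarith : (0 : ℝ) < Real.sqrt ρ), ← Real.sqrt_mul (div_nonneg hwe.le hwe'.le)]
      rw [← Real.sqrt_one]
      exact Real.sqrt_le_sqrt (by rw [div_mul_eq_mul_div, le_div_iff₀ hwe']; linarith)
    have habs : |Real.sqrt (w e / w e') - 1| ≤ Real.sqrt ρ - 1 := by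
      rw [abs_le]
      refine ⟨?_, by linarith⟩
      -- `1 − 1/√ρ ≤ √ρ − 1`
      have hinv : 1 - (Real.sqrt ρ - 1) ≤ 1 / Real.sqrt ρ := by
        rw [le_div_iff₀ (by linarith : (0 : ℝ) < Real.sqrt ρ)]
        nlinarith
      linarith
    calc h e e' * |Real.sqrt (w e / w e') - 1| ≤ h e e' * (Real.sqrt ρ - 1) :=
          mul_le_mul_of_nonneg_left habs (hh0 e e')
      _ = (Real.sqrt ρ - 1) * h e e' := by ring
  have hcol : ∀ e', ∑ e, h e e' ≤ H := fun e' => by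
    rw [show ∑ e, h e e' = ∑ e, h e' e from sum_congr rfl fun e _ => hsymm e e']; exact hrow e'
  refine ⟨fun e => ?_, fun e' => ?_⟩
  · calc ∑ e', h e e' * |Real.sqrt (w e / w e') - 1| ≤ ∑ e', (Real.sqrt ρ - 1) * h e e' :=
          sum_le_sum fun e' _ => hpt e e'
      _ = (Real.sqrt ρ - 1) * ∑ e', h e e' := by rw [mul_sum]
      _ ≤ (Real.sqrt ρ - 1) * H := mul_le_mul_of_nonneg_left (hrow e) hρ1
  · calc ∑ e, h e e' * |Real.sqrt (w e / w e') - 1| ≤ ∑ e, (Real.sqrt ρ - 1) * h e e' :=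
          sum_le_sum fun e _ => hpt e e'
      _ = (Real.sqrt ρ - 1) * ∑ e, h e e' := by rw [mul_sum]
      _ ≤ (Real.sqrt ρ - 1) * H := mul_le_mul_of_nonneg_left (hcol e') hρ1

/-- Hence `Gam2W_ge_theta` CONTAINS the tree's `Gam2W_ge` (same constant on admissible weights). [folklore] -/
theorem Gam2W_ge_of_theta (hN : N ≠ 0) {S u : Cfg ι N → ℝ} (hS : ContDiff ℝ ∞ S) (hu : ContDiff ℝ ∞ u)
    {Λ H ρ : ℝ} {h : ι → ι → ℝ} {w : ι → ℝ} (hHess : HessBound S Λ) (hOff : OffDiagHessBound S h)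
    (hh0 : ∀ e e', 0 ≤ h e e') (hsymm : ∀ e e', h e e' = h e' e) (hrow : ∀ e, ∑ e', h e e' ≤ H)
    (hρ : 1 ≤ ρ) (hw : AdmissibleWeights h ρ w) (g : PSU ι N) :
    ((N : ℝ) / 2 - Λ - (Real.sqrt ρ - 1) * H) * GamW w u u (emb g) ≤ Gam2W w S u (emb g) := by
  obtain ⟨hr, hc⟩ := theta_le_of_admissible hh0 hsymm hrow hρ hw
  exact Gam2W_ge_theta hN hS hu hHess hOff hh0 hw.1 hr hc g

end Theta

/-! ## ── part 04 · `Gaps` — §4 the typed gap list ── -/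

/-! ## §4 The two gaps between the door and renormalisation-group output, typed (GAP-STATED) -/

section Gaps

/-- **G1 — Θ-BOCHNER as a `Prop` (PROVED below: `thetaBochner_holds`, from §4a `Gam2W_ge_theta`; kept as a named `Prop` because the
memo's gap table refers to it).**  Generalisation of `SharpClustering.Gam2W_ge`.
The weighted Bochner inequality with GENERAL positive link weights `w`: the admissibility hypothesis
`AdmissibleWeights h ρ w` (interacting links carry weights within a factor `ρ`) and its loss `(√ρ − 1)·H` are replaced
by the loss `Θ` = the larger of the row and column sums of `h e e' · |√(w e / w e') − 1|`.  For a QUASI-LOCAL remainder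
(`h e e' ≤ C e^{−κ₀·dist}`, every pair of links interacting) admissible weights force `max w / min w ≤ ρ` — the
contrast between the two supports is at most `ρ` whatever their separation `m` (no decay in `m`; likewise the tree's
`h e e' ≠ 0 → D e ≤ D e' + 1` forces `m ≤ 1`) — while `Θ(w = ρ^{D}) = sup_e ∑_{e'} h e e' (ρ^{|D e − D e'|/2} − 1) → 0`
as `ρ → 1` whenever `log ρ / 2 < κ₀`, for every `m`: this is the form an RG remainder needs.  What REMAINS open
downstream is mechanical: `cov_step`, `covariance_le`, `cov_exp_decay_of_distFun` re-run with the curvature constant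
abstract (`CovarianceLeOfCurvature` below) and the bookkeeping `Θ(ρ^{D})` for an exponential profile. [folklore] -/
@[folklore]
def ThetaBochner : Prop :=
  ∀ (ι : Type) [Fintype ι] [DecidableEq ι] (N : ℕ), N ≠ 0 →
    ∀ (S u : Cfg ι N → ℝ), ContDiff ℝ ∞ S → ContDiff ℝ ∞ u →
    ∀ (Λ Θ : ℝ) (h : ι → ι → ℝ) (w : ι → ℝ), HessBound S Λ → OffDiagHessBound S h →
      (∀ e e', 0 ≤ h e e') → (∀ e e', h e e' = h e' e) → (∀ e, 0 < w e) →
      (∀ e, ∑ e', h e e' * |Real.sqrt (w e / w e') - 1| ≤ Θ) →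
      (∀ e', ∑ e, h e e' * |Real.sqrt (w e / w e') - 1| ≤ Θ) →
      ∀ g : PSU ι N, ((N : ℝ) / 2 - Λ - Θ) * GamW w u u (emb g) ≤ Gam2W w S u (emb g)

/-- Consistency of G1 with the tree (unit weights, `Θ = 0`): `ThetaBochner` contains the UNWEIGHTED integrated-free
Bochner inequality `(N/2 − Λ)·Γ(u,u) ≤ Γ₂(u)` pointwise. [folklore] -/
theorem thetaBochner_unweighted (hΘ : ThetaBochner) {ι : Type} [Fintype ι] [DecidableEq ι] {N : ℕ} (hN : N ≠ 0)
    {S u : Cfg ι N → ℝ} (hS : ContDiff ℝ ∞ S) (hu : ContDiff ℝ ∞ u) {Λ : ℝ} {h : ι → ι → ℝ}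
    (hHess : HessBound S Λ) (hOff : OffDiagHessBound S h) (hh0 : ∀ e e', 0 ≤ h e e')
    (hsymm : ∀ e e', h e e' = h e' e) (g : PSU ι N) :
    ((N : ℝ) / 2 - Λ) * GamW (fun _ => (1 : ℝ)) u u (emb g) ≤ Gam2W (fun _ => (1 : ℝ)) S u (emb g) := by
  have h1 : ∀ e : ι, ∑ e' : ι, h e e' * |Real.sqrt ((1 : ℝ) / 1) - 1| ≤ 0 := fun e => by simp
  have h2 : ∀ e' : ι, ∑ e : ι, h e e' * |Real.sqrt ((1 : ℝ) / 1) - 1| ≤ 0 := fun e' => by simp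
  have := hΘ ι N hN S u hS hu Λ 0 h (fun _ => 1) hHess hOff hh0 hsymm (fun _ => one_pos) h1 h2 g
  simpa using this

/-- ★ G1 at the Γ₂ level is a THEOREM: `ThetaBochner` holds (by `Gam2W_ge_theta`). [folklore] -/
theorem thetaBochner_holds : ThetaBochner :=
  fun _ _ _ _ hN _ _ hS hu _ _ _ _ hHess hOff hh0 _ hw hrow hcol g =>
    Gam2W_ge_theta hN hS hu hHess hOff hh0 hw hrow hcol g

/-- **G1′ — COVARIANCE FROM ABSTRACT CURVATURE as a `Prop` (PROVED in §4b: `covarianceLeOfCurvature_holds`; kept as a named `Prop`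
for the memo's gap table).**
`SharpClustering.covariance_le` with the pointwise weighted curvature inequality as an ABSTRACT hypothesis
`K·Γ^w(u,u) ≤ Γ₂^w(u)` (so that `Gam2W_ge_theta` can be plugged in with `K = N/2 − Λ − Θ`); proof (§4b) = the tree's
`SharpClusteringEnergy` + `SharpClusteringCovariance` with the constant renamed (the tree calls `Gam2W_ge` at exactly one
place, `SharpClusteringEnergy` l.132). [folklore] -/
@[folklore]
def CovarianceLeOfCurvature : Prop :=
  ∀ (ι : Type) [Fintype ι] [DecidableEq ι] (N : ℕ), N ≠ 0 →
    ∀ (dS : ℕ) (S : Cfg ι N → ℝ), S ∈ polySpace ι N dS →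
    ∀ (K : ℝ) (w : ι → ℝ), (∀ e, 0 < w e) → 0 < K →
      (∀ u : Cfg ι N → ℝ, ContDiff ℝ ∞ u → ∀ g : PSU ι N, K * GamW w u u (emb g) ≤ Gam2W w S u (emb g)) →
      ∀ (f g : Cfg ι N → ℝ), ContDiff ℝ ∞ f → ContDiff ℝ ∞ g →
        K * |(∫ x : PSU ι N, Real.exp (S (emb x)) ∂(haarPi ι N)) *
                (∫ x : PSU ι N, Real.exp (S (emb x)) * (f (emb x) * g (emb x)) ∂(haarPi ι N)) -
              (∫ x : PSU ι N, Real.exp (S (emb x)) * f (emb x) ∂(haarPi ι N)) *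
                (∫ x : PSU ι N, Real.exp (S (emb x)) * g (emb x) ∂(haarPi ι N))| ≤
          (∫ x : PSU ι N, Real.exp (S (emb x)) ∂(haarPi ι N)) *
            (Real.sqrt (∫ x : PSU ι N, Real.exp (S (emb x)) * GamW (fun e => (w e)⁻¹) f f (emb x) ∂(haarPi ι N)) *
              Real.sqrt (∫ x : PSU ι N, Real.exp (S (emb x)) * GamW w g g (emb x) ∂(haarPi ι N)))

/-- ★ THE QUASI-LOCAL COVARIANCE BOUND modulo G1′: `CovarianceLeOfCurvature` + the proved `Gam2W_ge_theta` give
`covariance_le` with constant `N/2 − Λ − Θ` for GENERAL positive weights (no admissibility, no range hypothesis). [folklore] -/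
theorem covariance_le_theta_of (hC : CovarianceLeOfCurvature) {ι : Type} [Fintype ι] [DecidableEq ι] {N : ℕ}
    (hN : N ≠ 0) {dS : ℕ} {S : Cfg ι N → ℝ} (hSp : S ∈ polySpace ι N dS)
    {Λ Θ : ℝ} {h : ι → ι → ℝ} {w : ι → ℝ} (hHess : HessBound S Λ) (hOff : OffDiagHessBound S h)
    (hh0 : ∀ e e', 0 ≤ h e e') (hw : ∀ e, 0 < w e)
    (hrow : ∀ e, ∑ e', h e e' * |Real.sqrt (w e / w e') - 1| ≤ Θ)
    (hcol : ∀ e', ∑ e, h e e' * |Real.sqrt (w e / w e') - 1| ≤ Θ) (hK : 0 < (N : ℝ) / 2 - Λ - Θ)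
    {f g : Cfg ι N → ℝ} (hf : ContDiff ℝ ∞ f) (hg : ContDiff ℝ ∞ g) :
    ((N : ℝ) / 2 - Λ - Θ) *
        |(∫ x : PSU ι N, Real.exp (S (emb x)) ∂(haarPi ι N)) *
            (∫ x : PSU ι N, Real.exp (S (emb x)) * (f (emb x) * g (emb x)) ∂(haarPi ι N)) -
          (∫ x : PSU ι N, Real.exp (S (emb x)) * f (emb x) ∂(haarPi ι N)) *
            (∫ x : PSU ι N, Real.exp (S (emb x)) * g (emb x) ∂(haarPi ι N))| ≤
      (∫ x : PSU ι N, Real.exp (S (emb x)) ∂(haarPi ι N)) *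
        (Real.sqrt (∫ x : PSU ι N, Real.exp (S (emb x)) * GamW (fun e => (w e)⁻¹) f f (emb x) ∂(haarPi ι N)) *
          Real.sqrt (∫ x : PSU ι N, Real.exp (S (emb x)) * GamW w g g (emb x) ∂(haarPi ι N))) :=
  hC ι N hN dS S hSp _ w hw hK
    (fun _ hu g' => Gam2W_ge_theta hN (contDiff_of_mem_polySpace hSp) hu hHess hOff hh0 hw hrow hcol g') f g hf hg

/-- **S-POISSON (GAP-STATED; conjectured generalisation of `SharpClustering.covariance_le`, NOT proved here).**
The covariance bound for SMOOTH (not necessarily polynomial) potentials `S`: the tree needs `S ∈ polySpace ι N dS`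
only to solve the Poisson equation `L_S φ = g − ⟨g⟩` approximately inside a finite-dimensional invariant space
(`poincare_of_approx`); for smooth `S` on the compact group `SU(N)^E` elliptic regularity gives an exact smooth
solution per finite volume, with the SAME volume-free constants.  The last-scale effective action of a
renormalisation-group flow is real-analytic, not polynomial, in the link entries. [folklore] -/
@[folklore]
def SmoothCovarianceLe : Prop :=
  ∀ (ι : Type) [Fintype ι] [DecidableEq ι] (N : ℕ), N ≠ 0 →
    ∀ (S : Cfg ι N → ℝ), ContDiff ℝ ∞ S →
    ∀ (Λ H ρ : ℝ) (h : ι → ι → ℝ) (w : ι → ℝ), HessBound S Λ → OffDiagHessBound S h →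
      (∀ e e', 0 ≤ h e e') → (∀ e e', h e e' = h e' e) → (∀ e, ∑ e', h e e' ≤ H) →
      1 ≤ ρ → AdmissibleWeights h ρ w → 0 < (N : ℝ) / 2 - Λ - (Real.sqrt ρ - 1) * H →
      ∀ (f g : Cfg ι N → ℝ), ContDiff ℝ ∞ f → ContDiff ℝ ∞ g →
        ((N : ℝ) / 2 - Λ - (Real.sqrt ρ - 1) * H) *
            |(∫ x : PSU ι N, Real.exp (S (emb x)) ∂(haarPi ι N)) *
                (∫ x : PSU ι N, Real.exp (S (emb x)) * (f (emb x) * g (emb x)) ∂(haarPi ι N)) -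
              (∫ x : PSU ι N, Real.exp (S (emb x)) * f (emb x) ∂(haarPi ι N)) *
                (∫ x : PSU ι N, Real.exp (S (emb x)) * g (emb x) ∂(haarPi ι N))| ≤
          (∫ x : PSU ι N, Real.exp (S (emb x)) ∂(haarPi ι N)) *
            (Real.sqrt (∫ x : PSU ι N, Real.exp (S (emb x)) * GamW (fun e => (w e)⁻¹) f f (emb x) ∂(haarPi ι N)) *
              Real.sqrt (∫ x : PSU ι N, Real.exp (S (emb x)) * GamW w g g (emb x) ∂(haarPi ι N)))

/-- Consistency of S-POISSON with the tree: it CONTAINS `SharpClustering.covariance_le` (polynomials are smooth). [folklore] -/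
theorem smoothCovarianceLe_of_poly (hP : SmoothCovarianceLe) {ι : Type} [Fintype ι] [DecidableEq ι] {N : ℕ}
    (hN : N ≠ 0) {dS : ℕ} {S : Cfg ι N → ℝ} (hSp : S ∈ polySpace ι N dS)
    {Λ H ρ : ℝ} {h : ι → ι → ℝ} {w : ι → ℝ} (hHess : HessBound S Λ) (hOff : OffDiagHessBound S h)
    (hh0 : ∀ e e', 0 ≤ h e e') (hsymm : ∀ e e', h e e' = h e' e) (hrow : ∀ e, ∑ e', h e e' ≤ H)
    (hρ : 1 ≤ ρ) (hw : AdmissibleWeights h ρ w) (hK : 0 < (N : ℝ) / 2 - Λ - (Real.sqrt ρ - 1) * H)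
    {f g : Cfg ι N → ℝ} (hf : ContDiff ℝ ∞ f) (hg : ContDiff ℝ ∞ g) :
    ((N : ℝ) / 2 - Λ - (Real.sqrt ρ - 1) * H) *
        |(∫ x : PSU ι N, Real.exp (S (emb x)) ∂(haarPi ι N)) *
            (∫ x : PSU ι N, Real.exp (S (emb x)) * (f (emb x) * g (emb x)) ∂(haarPi ι N)) -
          (∫ x : PSU ι N, Real.exp (S (emb x)) * f (emb x) ∂(haarPi ι N)) *
            (∫ x : PSU ι N, Real.exp (S (emb x)) * g (emb x) ∂(haarPi ι N))| ≤
      (∫ x : PSU ι N, Real.exp (S (emb x)) ∂(haarPi ι N)) *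
        (Real.sqrt (∫ x : PSU ι N, Real.exp (S (emb x)) * GamW (fun e => (w e)⁻¹) f f (emb x) ∂(haarPi ι N)) *
          Real.sqrt (∫ x : PSU ι N, Real.exp (S (emb x)) * GamW w g g (emb x) ∂(haarPi ι N))) :=
  hP ι N hN S (contDiff_of_mem_polySpace hSp) Λ H ρ h w hHess hOff hh0 hsymm hrow hρ hw hK f g hf hg

end Gaps

end Summit.Ventures.YMGap.BEDoor
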